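import Mathlib.Order.Filter.AtTopBot.CountablyGenerated
import Literature.Analysis.FluidPDE.KNSSTypeIRateCore
import Literature.Analysis.FluidPDE.KNSSTypeIRateLimit
import Literature.Analysis.FluidPDE.KNSSTypeIRateProofs
import HarnessLib

/-!
# KNSS 2009, proof of Theorem 6.2: Steps 5–6 from their three ingredients (the glue, proved)

Analysis/FluidPDE proof file for the second layer (`KNSSTypeIRateCore`) of the decomposition
of `Literature.Analysis.FluidPDE.KNSS2009_regularity_typeI_rate` (Koch–Nadirashvili–Seregin–
Šverák, Acta Math. 203 (2009) = arXiv:0709.3599, Theorem 6.2). It proves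

* `KNSS2009_typeI_rate_blowupSequence_of_core :
    KNSS2009_typeI_rate_compactness → KNSS2009_typeI_rate_liouville →
    KNSS2009_typeI_rate_vertex → KNSS2009_typeI_rate_blowupSequence`,

the glue of Steps 5–6 of the printed proof (arXiv p. 13): along every subsequence of the data,
the compactness ingredient gives a further subsequence converging slice-wise locally uniformly
to a bounded ancient mild solution `W`; `W` is bounded by `K` (the cylinders `𝒞_k` recede,
`eventually_lt_cylRadius_sub`), inherits (wkbound3), and is independent of `x₂`
(`eq_of_tendstoLocallyUniformly_of_rot_about`, `KNSSTypeIRateLimit`, applied to a tail of the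
sequence on which the slice lies in the domain of every `w⁽ᵏ⁾`); the Liouville ingredient gives
`W = 0`; the vertex ingredient and the pointwise convergence `w⁽ᵏ⁾(0, −δ) → W(0, −δ) = 0` give
`w⁽ᵏ⁾(0, 0) → 0` along the subsequence; and a sequence all of whose subsequences have a
subsequence tending to `0` tends to `0` (Mathlib `tendsto_of_subseq_tendsto`). With the first
layer this yields

* `KNSS2009_regularity_typeI_rate_of_core : KNSS2009_regularity_bound_C_over_r →
    KNSS2009_typeI_rate_compactness → KNSS2009_typeI_rate_liouville →
    KNSS2009_typeI_rate_vertex → KNSS2009_regularity_typeI_rate`.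

## References

* G. Koch, N. Nadirashvili, G. Seregin, V. Šverák, Acta Math. 203 (2009) 83–105 =
  arXiv:0709.3599, proof of Theorem 6.2, p. 13. [KochNadirashviliSereginSverak2009]
-/

noncomputable section

open Set Function Filter
open _root_.Topology

namespace Literature.Analysis.FluidPDE

/-! ### Two elementary lemmas -/

/-- Re-indexing a locally uniformly convergent family along a map tending to the index filter
preserves locally uniform convergence. [folklore] -/
theorem tendstoLocallyUniformly_comp_of_tendsto {α β ι ι' : Type*} [TopologicalSpace α]
    [UniformSpace β] {F : ι → α → β} {f : α → β} {p : Filter ι} {p' : Filter ι'}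
    (h : TendstoLocallyUniformly F f p) {g : ι' → ι} (hg : Tendsto g p' p) :
    TendstoLocallyUniformly (fun n => F (g n)) f p' := fun u hu x => by
  obtain ⟨t, ht, hev⟩ := h u hu x
  exact ⟨t, ht, hg.eventually hev⟩

/-- **The cylinders `𝒞_k` recede**: for fixed `x`, eventually `M_k/2 < cylRadius (x − c_k)`,
`c_k = −M_k e₁`, when `M_k → ∞` (indeed `cylRadius (x − c_k) ≥ |x₁ + M_k| ≥ M_k − |x₁|`;
KNSS 2009, p. 13: "In view of (wkbound) we have `|w| ≤ 2`"). [cite: KochNadirashviliSereginSverak2009, proof of Thm 6.2 (arXiv p. 13)] -/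
theorem eventually_lt_cylRadius_sub {M : ℕ → ℝ} (hM : Tendsto M atTop atTop)
    (x : EuclideanSpace ℝ (Fin 3)) :
    ∀ᶠ k in atTop, M k / 2 < cylRadius (x - EuclideanSpace.single 0 (-M k)) := by
  filter_upwards [hM.eventually_gt_atTop (2 * |x 0|)] with k hk
  have e0 : (x - EuclideanSpace.single 0 (-M k) : EuclideanSpace ℝ (Fin 3)) 0 = x 0 + M k := by
    simp
  have e1 : (x - EuclideanSpace.single 0 (-M k) : EuclideanSpace ℝ (Fin 3)) 1 = x 1 := by
    simp
  have h1 : |x 0 + M k| ≤ cylRadius (x - EuclideanSpace.single 0 (-M k)) := by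
    unfold cylRadius
    rw [e0, e1]
    calc |x 0 + M k| = Real.sqrt ((x 0 + M k) ^ 2) := (Real.sqrt_sq_eq_abs _).symm
      _ ≤ Real.sqrt ((x 0 + M k) ^ 2 + (x 1) ^ 2) :=
        Real.sqrt_le_sqrt (by nlinarith [sq_nonneg (x 1)])
  have h2 : M k - |x 0| ≤ |x 0 + M k| := by
    have := abs_sub_abs_le_abs_sub (M k) (-(x 0))
    rw [abs_neg, sub_neg_eq_add, add_comm] at this
    linarith [le_abs_self (M k)]
  have h3 : 0 ≤ |x 0| := abs_nonneg _
  linarith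

/-! ### The glue -/

/-- **Steps 5–6 of the proof of KNSS 2009, Theorem 6.2, from their three ingredients** (module
docstring): compactness (Lemma 6.1), the Liouville step (Theorem 5.1 with Remark 6.1) and the
vertex estimate imply `KNSS2009_typeI_rate_blowupSequence` (`w⁽ᵏ⁾(0, 0) → 0`). [cite: KochNadirashviliSereginSverak2009, proof of Thm 6.2 (arXiv p. 13)] -/
theorem KNSS2009_typeI_rate_blowupSequence_of_core (h1 : KNSS2009_typeI_rate_compactness)
    (h2 : KNSS2009_typeI_rate_liouville) (h3 : KNSS2009_typeI_rate_vertex) :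
    KNSS2009_typeI_rate_blowupSequence := by
  intro C K M A B w q hC hK hMpos hMlim hAlim hBpos hw hL hsym hI hoff hmul
  refine tendsto_of_subseq_tendsto fun ψ hψ => ?_
  -- compactness along `ψ`
  obtain ⟨φ, W, hφ, hWc, hWdiv, hWdec, hWmild, hWconv⟩ :=
    h1 hC hK (fun k => hMpos (ψ k)) (hMlim.comp hψ) (hAlim.comp hψ) (fun k => hBpos (ψ k))
      (fun k => hw (ψ k)) (fun k => hL (ψ k)) (fun k => hI (ψ k)) (fun k => hmul (ψ k))
  have hφt : Tendsto φ atTop atTop := hφ.tendsto_atTop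
  have hθ : Tendsto (fun k => ψ (φ k)) atTop atTop := hψ.comp hφt
  have hθM : Tendsto (fun k => M (ψ (φ k))) atTop atTop := hMlim.comp hθ
  have hθA : Tendsto (fun k => A (ψ (φ k))) atTop atBot := hAlim.comp hθ
  -- continuity of the slices of `W`
  have hWcont : ∀ t < 0, Continuous (W t) := fun t ht =>
    hWc.comp_continuous (continuous_const.prodMk continuous_id) fun x => ⟨ht, mem_univ x⟩
  -- pointwise convergence of the slices along `ψ ∘ φ`
  have hpt : ∀ t < 0, ∀ x, Tendsto (fun k => w (ψ (φ k)) t x) atTop (𝓝 (W t x)) :=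
    fun t ht x => (tendstoLocallyUniformlyOn_univ.2 (hWconv t ht)).tendsto_at (mem_univ x)
  -- `W` is bounded by `K` (the cylinders recede)
  have hWbdd : ∃ K' : ℝ, ∀ t < 0, ∀ x, ‖W t x‖ ≤ K' := by
    refine ⟨K, fun t ht x => le_of_tendsto (hpt t ht x).norm ?_⟩
    filter_upwards [hθA.eventually_lt_atBot t, eventually_lt_cylRadius_sub hθM x] with k hk1 hk2
    exact hoff (ψ (φ k)) t ⟨hk1, ht.le⟩ x hk2
  -- `W` is independent of `x₂`
  have hWx2 : ∀ t < 0, ∀ (x : EuclideanSpace ℝ (Fin 3)) (δ : ℝ),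
      W t (x + EuclideanSpace.single 1 δ) = W t x := by
    intro t ht x δ
    obtain ⟨k₀, hk₀⟩ := eventually_atTop.1 (hθA.eventually_lt_atBot t)
    have hconv' : TendstoLocallyUniformly (fun k => w (ψ (φ (k + k₀))) t) (W t) atTop :=
      tendstoLocallyUniformly_comp_of_tendsto (hWconv t ht) (tendsto_add_atTop_nat k₀)
    refine eq_of_tendstoLocallyUniformly_of_rot_about (M := fun k => M (ψ (φ (k + k₀))))
      (hθM.comp (tendsto_add_atTop_nat k₀)) (fun k θ' y => ?_) hconv' (hWcont t ht) x δ
    exact hsym (ψ (φ (k + k₀))) t ⟨hk₀ _ (Nat.le_add_left _ _), ht.trans (hBpos _)⟩ θ' y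
  -- hence `W = 0`
  have hW0 : ∀ t < 0, ∀ x, W t x = 0 := h2 hWc hWbdd hWdiv hWmild hWx2 hWdec
  -- the vertex estimate along `ψ`
  have hV := h3 hC hK (fun k => hMpos (ψ k)) (hMlim.comp hψ) (hAlim.comp hψ)
    (fun k => hBpos (ψ k)) (fun k => hw (ψ k)) (fun k => hL (ψ k)) (fun k => hI (ψ k))
    (fun k => hoff (ψ k)) (fun k => hmul (ψ k))
  -- conclusion along `ψ ∘ φ`
  refine ⟨φ, Metric.tendsto_nhds.2 fun ε hε => ?_⟩
  obtain ⟨δ, hδ, hev⟩ := hV (ε / 3) (by positivity)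
  have hp : Tendsto (fun k => w (ψ (φ k)) (-δ) 0) atTop (𝓝 0) := by
    have := hpt (-δ) (by linarith) 0
    rwa [hW0 _ (by linarith)] at this
  have e3 : ∀ᶠ k in atTop, ‖w (ψ (φ k)) (-δ) 0‖ < ε / 3 := by
    have := Metric.tendsto_nhds.1 hp (ε / 3) (by positivity)
    simpa only [dist_zero_right] using this
  have e4 : ∀ᶠ k in atTop, ∀ τ ∈ Icc (-δ) 0, ‖w (ψ (φ k)) 0 0 - w (ψ (φ k)) τ 0‖ ≤ ε / 3 :=
    hφt.eventually hev
  filter_upwards [e3, e4] with k hk3 hk4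
  rw [dist_zero_right]
  have h5 := hk4 (-δ) ⟨le_rfl, by linarith⟩
  calc ‖w (ψ (φ k)) 0 0‖
      = ‖(w (ψ (φ k)) 0 0 - w (ψ (φ k)) (-δ) 0) + w (ψ (φ k)) (-δ) 0‖ := by rw [sub_add_cancel]
    _ ≤ ‖w (ψ (φ k)) 0 0 - w (ψ (φ k)) (-δ) 0‖ + ‖w (ψ (φ k)) (-δ) 0‖ := norm_add_le _ _
    _ < ε := by linarith

/-- **KNSS 2009, Theorem 6.2 as vendored, from Theorem 6.1 and the three ingredients of
Steps 5–6 of its proof** — compactness (Lemma 6.1), the Liouville step (Theorem 5.1 with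
Remark 6.1), the vertex estimate — everything else being proved in the tree (two layers:
`KNSSTypeIRate`, `KNSSTypeIRateCore`). [cite: KochNadirashviliSereginSverak2009, Thm 6.2 and its proof (arXiv pp. 12–13)] -/
theorem KNSS2009_regularity_typeI_rate_of_core (h61 : KNSS2009_regularity_bound_C_over_r)
    (h1 : KNSS2009_typeI_rate_compactness) (h2 : KNSS2009_typeI_rate_liouville)
    (h3 : KNSS2009_typeI_rate_vertex) : KNSS2009_regularity_typeI_rate :=
  KNSS2009_regularity_typeI_rate_of_blowupSequence h61
    (KNSS2009_typeI_rate_blowupSequence_of_core h1 h2 h3)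

end Literature.Analysis.FluidPDE

end
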